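import Mathlib.LinearAlgebra.Projectivization.Basic
import Mathlib.Geometry.Manifold.Instances.Sphere
import Mathlib.Analysis.Complex.Basic
import Mathlib.Analysis.Normed.Module.Connected
import Mathlib.Analysis.Normed.Module.RCLike.Basic
import Mathlib.Geometry.Manifold.Diffeomorph
import Mathlib.AlgebraicTopology.FundamentalGroupoid.SimplyConnected
import Literature.Topology.FourManifolds.SmoothOrientation
import HarnessLib

-- provenance: harness21/H21/H21/Prelude/FourManM/ComplexProjectiveSpace.lean @ d549e1a (interim HEAD d8f2665); M5 mechanical rewrite
/-!
# Complex projective space `ℂℙⁿ` as a real-analytic `2n`-manifold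

Trunk **T-4MAN** (`H21/Outlines/FourManM.md`, §1 (D7), §2 (C17); notion
`complex_projective_space_manifold`).

Mathlib has the projectivization `Projectivization K V` of a vector space (linear algebra only:
no topology, no charts — checked in `Mathlib/LinearAlgebra/Projectivization/`). This file equips
the type synonym `Literature.ComplexProjectiveSpace n := Projectivization ℂ (Fin (n + 1) → ℂ)` with

* the quotient topology of `{v : Fin (n + 1) → ℂ // v ≠ 0}` (`mk`, `continuous_mk`,
  `isQuotientMap_mk`, `isOpenMap_mk`);
* the `n + 1` standard affine charts `affineChart i` (source `{[v] | v i ≠ 0}`, target the whole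
  model space), valued in the *real* model space `EuclideanSpace ℝ (Fin (2 * n))` through the
  real-linear isometry-free identification `realCoordinates : (Fin n → ℂ) ≃L[ℝ] EuclideanSpace ℝ
  (Fin (2 * n))` (real parts in the slots `finProdFinEquiv (0, j)`, imaginary parts in the slots
  `finProdFinEquiv (1, j)`), so that `ℂℙ²` is a `ChartedSpace (EuclideanSpace ℝ (Fin 4))`
  4-manifold like every manifold of the SPC4 statements;
* the instances `ChartedSpace`, `IsManifold (𝓡 (2 * n)) ω` (the transition maps
  `(z_j / z_i)_j ↦ (z_j / z_k)_j` are rational, hence analytic: proved), `T2Space`,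
  `SecondCountableTopology`, `CompactSpace` (image of the unit sphere), `ConnectedSpace`,
  `Nonempty`;
* the literature theorems (sorried): `ℂℙⁿ` is simply connected and orientable, `ℂℙ¹ ≅ 𝕊²`;
* `ComplexProjectivePlane := ComplexProjectiveSpace 2` with its instances re-exported at the
  literal model `EuclideanSpace ℝ (Fin 4)` (instances keyed at `Fin (2 * n)` are not found at
  `Fin 4` by instance search; outline review #3).

Sources: J. Milnor, J. Stasheff, *Characteristic Classes* (1974), §14; P. Griffiths, J. Harris,
*Principles of Algebraic Geometry* (1978), Ch. 0 §2; outline `H21/Outlines/FourManM.md`.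

Design choices. The charts are the honest affine charts; `chartAt p` is the affine chart of
*some* index `i` with `p i ≠ 0` (classical choice over a true existential). Off its source the
coordinate function `affineCoord i` takes the junk value dictated by `x / 0 = 0`; this is never
used since `affineChart i` records the source.
-/

open scoped Manifold ContDiff Topology ComplexConjugate
open Set Module Function Topology

set_option autoImplicit false

noncomputable section

namespace Literature.Topology.FourManifolds

/-- Local notation: `𝔼 n` is the model Euclidean space `EuclideanSpace ℝ (Fin n)`. -/
local notation "𝔼 " n:arg => EuclideanSpace ℝ (Fin n)

/-- Local notation: `𝕊 n` is the unit sphere in `EuclideanSpace ℝ (Fin (n + 1))`. -/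
local notation "𝕊 " n:arg => (Metric.sphere (0 : EuclideanSpace ℝ (Fin (n + 1))) 1)

/-- **Complex projective `n`-space** `ℂℙⁿ`: the set of complex lines in `ℂⁿ⁺¹`, realised as
Mathlib's `Projectivization ℂ (Fin (n + 1) → ℂ)`. A type synonym, so that the topology and the
manifold structure below are registered on `ComplexProjectiveSpace n` only.
Milnor–Stasheff, *Characteristic Classes*, §14. [folklore] -/
def ComplexProjectiveSpace (n : ℕ) : Type :=
  Projectivization ℂ (Fin (n + 1) → ℂ)

namespace ComplexProjectiveSpace

variable {n : ℕ}

/-- The quotient map `ℂⁿ⁺¹ ∖ {0} → ℂℙⁿ`, `v ↦ [v]` (Milnor–Stasheff, §14). [folklore] -/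
def mk (v : {v : Fin (n + 1) → ℂ // v ≠ 0}) : ComplexProjectiveSpace n :=
  Projectivization.mk' ℂ v

/-- Every point of `ℂℙⁿ` is the class of a nonzero vector. [folklore] -/
theorem mk_surjective : Surjective (mk : _ → ComplexProjectiveSpace n) := by
  rintro ⟨v⟩
  exact ⟨v, rfl⟩

/-- Two nonzero vectors define the same point of `ℂℙⁿ` iff they differ by a (nonzero) scalar
(Mathlib `Projectivization.mk_eq_mk_iff'`). [folklore] -/
theorem mk_eq_mk_iff (v w : {v : Fin (n + 1) → ℂ // v ≠ 0}) :
    mk v = mk w ↔ ∃ a : ℂ, a • (w : Fin (n + 1) → ℂ) = v :=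
  Projectivization.mk_eq_mk_iff' ℂ _ _ v.2 w.2

/-- Induction principle: to prove a property of all points of `ℂℙⁿ` it suffices to prove it for
the classes `mk v` of nonzero vectors. [folklore] -/
@[elab_as_elim]
theorem ind {P : ComplexProjectiveSpace n → Prop} (h : ∀ v, P (mk v))
    (p : ComplexProjectiveSpace n) : P p := by
  obtain ⟨v, rfl⟩ := mk_surjective p
  exact h v

/-- The **quotient topology** on `ℂℙⁿ`: the finest topology making `mk : ℂⁿ⁺¹ ∖ {0} → ℂℙⁿ`
continuous (Milnor–Stasheff, §14). [folklore] -/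
instance instTopologicalSpace : TopologicalSpace (ComplexProjectiveSpace n) :=
  TopologicalSpace.coinduced (mk : {v : Fin (n + 1) → ℂ // v ≠ 0} → _) inferInstance

/-- The quotient map `mk : ℂⁿ⁺¹ ∖ {0} → ℂℙⁿ` is continuous (by definition of the topology). [folklore] -/
theorem continuous_mk : Continuous (mk : _ → ComplexProjectiveSpace n) :=
  continuous_coinduced_rng

/-- `mk : ℂⁿ⁺¹ ∖ {0} → ℂℙⁿ` is a topological quotient map (Milnor–Stasheff, §14). [folklore] -/
theorem isQuotientMap_mk : IsQuotientMap (mk : _ → ComplexProjectiveSpace n) :=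
  ⟨⟨rfl⟩, mk_surjective⟩

/-- Dilation of nonzero vectors by a unit `c ∈ ℂˣ`. [folklore] -/
def dilate (c : ℂˣ) (v : {v : Fin (n + 1) → ℂ // v ≠ 0}) : {v : Fin (n + 1) → ℂ // v ≠ 0} :=
  ⟨(c : ℂ) • (v : Fin (n + 1) → ℂ), smul_ne_zero (Units.ne_zero c) v.2⟩

/-- Dilations are continuous. [folklore] -/
theorem continuous_dilate (c : ℂˣ) : Continuous (dilate (n := n) c) :=
  ((continuous_const (y := (c : ℂ))).smul continuous_subtype_val).subtype_mk _

/-- Dilation does not change the class in `ℂℙⁿ`. [folklore] -/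
@[simp] theorem mk_dilate (c : ℂˣ) (v : {v : Fin (n + 1) → ℂ // v ≠ 0}) :
    mk (dilate c v) = mk v :=
  (mk_eq_mk_iff _ _).2 ⟨c, rfl⟩

/-- `mk : ℂⁿ⁺¹ ∖ {0} → ℂℙⁿ` is an open map: the saturation of an open set `U` is the union of
its dilates `c • U`, `c ∈ ℂˣ` (Milnor–Stasheff, §14). [folklore] -/
theorem isOpenMap_mk : IsOpenMap (mk : _ → ComplexProjectiveSpace n) := by
  intro U hU
  rw [← isQuotientMap_mk.isOpen_preimage]
  have : mk ⁻¹' (mk '' U) = ⋃ c : ℂˣ, dilate c ⁻¹' U := by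
    ext v
    simp only [mem_preimage, mem_image, mem_iUnion]
    constructor
    · rintro ⟨u, hu, huv⟩
      obtain ⟨a, ha⟩ := (Projectivization.mk_eq_mk_iff ℂ _ _ u.2 v.2).1 huv
      refine ⟨a, ?_⟩
      convert hu
      exact Subtype.ext (by simpa [dilate, Units.smul_def] using ha)
    · rintro ⟨c, hc⟩
      exact ⟨_, hc, mk_dilate c v⟩
  rw [this]
  exact isOpen_iUnion fun c ↦ hU.preimage (continuous_dilate c)

/-- A map out of `ℂℙⁿ` is continuous on an open set as soon as its composite with `mk` is
continuous on the preimage (restriction of a quotient map to a saturated open set). [folklore] -/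
theorem continuousOn_of_comp_mk {X : Type*} [TopologicalSpace X] {f : ComplexProjectiveSpace n → X}
    {s : Set (ComplexProjectiveSpace n)} (hs : IsOpen s) (hf : ContinuousOn (f ∘ mk) (mk ⁻¹' s)) :
    ContinuousOn f s := by
  rw [continuousOn_open_iff hs]
  intro t ht
  rw [← isQuotientMap_mk.isOpen_preimage, preimage_inter]
  exact hf.isOpen_inter_preimage (hs.preimage continuous_mk) ht

/-- `ℂℙⁿ` is nonempty: it contains `[1 : ⋯ : 1]`. [folklore] -/
instance instNonempty : Nonempty (ComplexProjectiveSpace n) :=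
  ⟨mk ⟨fun _ ↦ 1, by simp [funext_iff]⟩⟩

/-! ### Real coordinates on `ℂⁿ` -/

/-- The realification `ℂⁿ ≃ₗ[ℝ] ℝ²ⁿ` as a real-linear equivalence onto the model space
`EuclideanSpace ℝ (Fin (2 * n))`: the real part of the `j`-th coordinate goes to the slot
`finProdFinEquiv (0, j)` and its imaginary part to the slot `finProdFinEquiv (1, j)`
(Griffiths–Harris, Ch. 0 §2). [folklore] -/
def realCoordinatesLinearEquiv (n : ℕ) : (Fin n → ℂ) ≃ₗ[ℝ] 𝔼 (2 * n) where
  toFun w := WithLp.toLp 2 fun m ↦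
    ![(w (finProdFinEquiv.symm m).2).re, (w (finProdFinEquiv.symm m).2).im]
      (finProdFinEquiv.symm m).1
  invFun x := fun j ↦ ⟨x (finProdFinEquiv (0, j)), x (finProdFinEquiv (1, j))⟩
  map_add' w w' := by
    ext m
    obtain ⟨⟨a, j⟩, rfl⟩ := finProdFinEquiv.surjective m
    fin_cases a <;> simp [-finProdFinEquiv_symm_apply]
  map_smul' r w := by
    ext m
    obtain ⟨⟨a, j⟩, rfl⟩ := finProdFinEquiv.surjective m
    fin_cases a <;> simp [-finProdFinEquiv_symm_apply]
  left_inv w := by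
    ext j
    simp
  right_inv x := by
    ext m
    obtain ⟨⟨a, j⟩, rfl⟩ := finProdFinEquiv.surjective m
    fin_cases a <;> simp [-finProdFinEquiv_symm_apply]

/-- The realification `ℂⁿ ≃L[ℝ] EuclideanSpace ℝ (Fin (2 * n))` as a continuous real-linear
equivalence (continuity is automatic in finite dimension). [folklore] -/
def realCoordinates (n : ℕ) : (Fin n → ℂ) ≃L[ℝ] 𝔼 (2 * n) :=
  (realCoordinatesLinearEquiv n).toContinuousLinearEquiv

/-! ### Affine charts -/

/-- The homogeneous-coordinate predicate `v i ≠ 0`, well defined on `ℂℙⁿ`; its locus is the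
source of the `i`-th affine chart (Griffiths–Harris, Ch. 0 §2). [folklore] -/
def CoordNeZero (i : Fin (n + 1)) : ComplexProjectiveSpace n → Prop :=
  Projectivization.lift (fun v ↦ (v : Fin (n + 1) → ℂ) i ≠ 0) (by
    rintro a b t h
    have ht : t ≠ 0 := by rintro rfl; exact a.2 (by simpa using h)
    have : (a : Fin (n + 1) → ℂ) i = t * (b : Fin (n + 1) → ℂ) i := by simp [h]
    simp [this, ht])

/-- `CoordNeZero i [v]` unfolds to `v i ≠ 0`. [folklore] -/
@[simp] theorem coordNeZero_mk (i : Fin (n + 1)) (v : {v : Fin (n + 1) → ℂ // v ≠ 0}) :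
    CoordNeZero i (mk v) ↔ (v : Fin (n + 1) → ℂ) i ≠ 0 :=
  Iff.rfl

/-- The domain `{[v] | v i ≠ 0}` of the `i`-th affine chart is open. [folklore] -/
theorem isOpen_setOf_coordNeZero (i : Fin (n + 1)) :
    IsOpen {p : ComplexProjectiveSpace n | CoordNeZero i p} := by
  rw [← isQuotientMap_mk.isOpen_preimage]
  exact isOpen_ne_fun (f := fun v : {v : Fin (n + 1) → ℂ // v ≠ 0} ↦ (v : Fin (n + 1) → ℂ) i)
    (g := fun _ ↦ 0) ((continuous_apply i).comp continuous_subtype_val) continuous_const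

/-- The affine chart domains cover `ℂℙⁿ`: every point has a nonzero homogeneous coordinate. [folklore] -/
theorem exists_coordNeZero (p : ComplexProjectiveSpace n) : ∃ i, CoordNeZero i p := by
  induction p using ind with
  | h v => simpa [CoordNeZero, mk] using Function.ne_iff.1 v.2

/-- The complex affine coordinates of the `i`-th chart, `[v] ↦ (v (i.succAbove j) / v i)ⱼ : ℂⁿ`
(junk value given by `x / 0 = 0` off the chart domain). Griffiths–Harris, Ch. 0 §2. [folklore] -/
def affineCoordComplex (i : Fin (n + 1)) : ComplexProjectiveSpace n → (Fin n → ℂ) :=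
  Projectivization.lift (fun v j ↦ (v : Fin (n + 1) → ℂ) (i.succAbove j) / (v : Fin (n + 1) → ℂ) i)
    (by
      rintro a b t h
      have ht : t ≠ 0 := by rintro rfl; exact a.2 (by simpa using h)
      funext j
      simp [h, mul_div_mul_left _ _ ht])

/-- The complex affine coordinates of `[v]` are `(v (i.succAbove j) / v i)ⱼ`. [folklore] -/
@[simp] theorem affineCoordComplex_mk (i : Fin (n + 1)) (v : {v : Fin (n + 1) → ℂ // v ≠ 0}) :
    affineCoordComplex i (mk v) =
      fun j ↦ (v : Fin (n + 1) → ℂ) (i.succAbove j) / (v : Fin (n + 1) → ℂ) i :=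
  rfl

/-- The real affine coordinates of the `i`-th chart, `[v] ↦ (v (i.succAbove j) / v i)ⱼ` read in
`EuclideanSpace ℝ (Fin (2 * n))` through `realCoordinates` (Milnor–Stasheff, §14). [folklore] -/
def affineCoord (i : Fin (n + 1)) : ComplexProjectiveSpace n → 𝔼 (2 * n) :=
  realCoordinates n ∘ affineCoordComplex i

/-- Homogenisation `ℂⁿ → ℂⁿ⁺¹ ∖ {0}`, `w ↦ (w₀, …, 1, …, w_{n-1})` with `1` inserted in slot `i`;
the inverse of the `i`-th affine chart before passing to the quotient. [folklore] -/
def homogenize (i : Fin (n + 1)) (w : Fin n → ℂ) : {v : Fin (n + 1) → ℂ // v ≠ 0} :=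
  ⟨Fin.insertNth i 1 w, fun h ↦ by simpa using congr_fun h i⟩

/-- Homogenisation is continuous. [folklore] -/
theorem continuous_homogenize (i : Fin (n + 1)) : Continuous (homogenize (n := n) i) :=
  have : Continuous fun w : Fin n → ℂ ↦ (Fin.insertNth i (1 : ℂ) w : Fin (n + 1) → ℂ) := by
    fun_prop
  this.subtype_mk _

/-- The **`i`-th affine chart** of `ℂℙⁿ`: source `{[v] | v i ≠ 0}`, target the whole model space
`EuclideanSpace ℝ (Fin (2 * n))`, `[v] ↦ (v (i.succAbove j) / v i)ⱼ` realified, with inverse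
`w ↦ [w₀ : ⋯ : 1 : ⋯ : w_{n-1}]` (Milnor–Stasheff, §14; Griffiths–Harris, Ch. 0 §2). [folklore] -/
def affineChart (i : Fin (n + 1)) :
    OpenPartialHomeomorph (ComplexProjectiveSpace n) (𝔼 (2 * n)) where
  toFun := affineCoord i
  invFun w := mk (homogenize i ((realCoordinates n).symm w))
  source := {p | CoordNeZero i p}
  target := univ
  map_source' _ _ := mem_univ _
  map_target' w _ := by simp [homogenize]
  left_inv' p hp := by
    induction p using ind with
    | h v =>
      simp only [affineCoord, comp_apply, affineCoordComplex_mk,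
        ContinuousLinearEquiv.symm_apply_apply, mk_eq_mk_iff, homogenize]
      replace hp : (v : Fin (n + 1) → ℂ) i ≠ 0 := hp
      refine ⟨((v : Fin (n + 1) → ℂ) i)⁻¹, ?_⟩
      symm
      rw [Fin.insertNth_eq_iff]
      constructor
      · simp [hp]
      · funext j
        simp [div_eq_inv_mul, Fin.removeNth]
  right_inv' w _ := by
    simp [affineCoord, homogenize]
  open_source := isOpen_setOf_coordNeZero i
  open_target := isOpen_univ
  continuousOn_toFun := by
    refine continuousOn_of_comp_mk (isOpen_setOf_coordNeZero i)
      ((realCoordinates n).continuous.comp_continuousOn ?_)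
    refine continuousOn_pi.2 fun j ↦ ?_
    exact (((continuous_apply _).comp continuous_subtype_val).continuousOn).div
      (((continuous_apply _).comp continuous_subtype_val).continuousOn) fun v hv ↦ hv
  continuousOn_invFun :=
    (continuous_mk.comp ((continuous_homogenize i).comp
      (realCoordinates n).symm.continuous)).continuousOn

/-- The source of the `i`-th affine chart is `{[v] | v i ≠ 0}`. [folklore] -/
@[simp] theorem affineChart_source (i : Fin (n + 1)) :
    (affineChart i).source = {p : ComplexProjectiveSpace n | CoordNeZero i p} := rfl

/-- The target of an affine chart is the whole model space. [folklore] -/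
@[simp] theorem affineChart_target (i : Fin (n + 1)) :
    (affineChart (n := n) i).target = univ := rfl

/-- The `i`-th affine chart is the function `affineCoord i`. [folklore] -/
theorem affineChart_apply (i : Fin (n + 1)) (p : ComplexProjectiveSpace n) :
    affineChart i p = affineCoord i p := rfl

/-- The inverse of the `i`-th affine chart is homogenisation followed by the quotient map. [folklore] -/
theorem affineChart_symm_apply (i : Fin (n + 1)) (w : 𝔼 (2 * n)) :
    (affineChart i).symm w = mk (homogenize i ((realCoordinates n).symm w)) := rfl

/-! ### The atlas and the analytic structure -/

/-- An index `i` with `p i ≠ 0`, i.e. an affine chart containing `p` (classical choice over the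
true existential `exists_coordNeZero`). [folklore] -/
def chartIndex (p : ComplexProjectiveSpace n) : Fin (n + 1) :=
  Classical.choose (exists_coordNeZero p)

/-- The chosen chart index of `p` is a nonzero homogeneous coordinate of `p`. [folklore] -/
theorem coordNeZero_chartIndex (p : ComplexProjectiveSpace n) : CoordNeZero (chartIndex p) p :=
  Classical.choose_spec (exists_coordNeZero p)

/-- `ℂℙⁿ` as a charted space on `EuclideanSpace ℝ (Fin (2 * n))`, with atlas the `n + 1` affine
charts (Milnor–Stasheff, §14). [folklore] -/
instance instChartedSpace : ChartedSpace (𝔼 (2 * n)) (ComplexProjectiveSpace n) where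
  atlas := range affineChart
  chartAt p := affineChart (chartIndex p)
  mem_chart_source p := coordNeZero_chartIndex p
  chart_mem_atlas _ := mem_range_self _

/-- The preferred chart at `p` is the affine chart of index `chartIndex p`. [folklore] -/
theorem chartAt_eq (p : ComplexProjectiveSpace n) :
    chartAt (𝔼 (2 * n)) p = affineChart (chartIndex p) :=
  rfl

/-- The atlas of `ℂℙⁿ` consists exactly of the `n + 1` affine charts. [folklore] -/
theorem mem_atlas_iff (e : OpenPartialHomeomorph (ComplexProjectiveSpace n) (𝔼 (2 * n))) :
    e ∈ atlas (𝔼 (2 * n)) (ComplexProjectiveSpace n) ↔ ∃ i, affineChart i = e :=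
  Iff.rfl

/-- The complex transition function between the affine charts `i` and `k`:
`w ↦ ((ŵ (k.succAbove j)) / ŵ k)ⱼ` where `ŵ = homogenize i w` (Griffiths–Harris, Ch. 0 §2). [folklore] -/
def transitionComplex (i k : Fin (n + 1)) (w : Fin n → ℂ) : Fin n → ℂ :=
  fun j ↦ (homogenize i w : Fin (n + 1) → ℂ) (k.succAbove j) / (homogenize i w : Fin (n + 1) → ℂ) k

/-- Each homogeneous coordinate of `homogenize i w` is a complex-analytic (constant or coordinate)
function of `w`. [folklore] -/
theorem contDiff_homogenize_apply (i m : Fin (n + 1)) :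
    ContDiff ℂ ω fun w : Fin n → ℂ ↦ (homogenize i w : Fin (n + 1) → ℂ) m := by
  rcases Fin.eq_self_or_eq_succAbove i m with rfl | ⟨j, rfl⟩
  · simp only [homogenize, Fin.insertNth_apply_same]
    exact contDiff_const
  · simp only [homogenize, Fin.insertNth_apply_succAbove]
    exact contDiff_apply ℂ ℂ j

/-- The complex transition functions are complex-analytic where defined. [folklore] -/
theorem contDiffOn_transitionComplex (i k : Fin (n + 1)) :
    ContDiffOn ℂ ω (transitionComplex i k) {w | (homogenize i w : Fin (n + 1) → ℂ) k ≠ 0} :=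
  contDiffOn_pi' fun j ↦ (contDiff_homogenize_apply i (k.succAbove j)).contDiffOn.div
    (contDiff_homogenize_apply i k).contDiffOn fun _ h ↦ h

/-- The change of affine charts is the realification of `transitionComplex i k`. [folklore] -/
theorem affineChart_symm_trans_apply (i k : Fin (n + 1)) (w : 𝔼 (2 * n)) :
    ((affineChart i).symm.trans (affineChart k)) w =
      realCoordinates n (transitionComplex i k ((realCoordinates n).symm w)) :=
  rfl

/-- The source of the change of affine charts `i → k` is `{w | (homogenize i w) k ≠ 0}` read in real
coordinates. [folklore] -/
theorem affineChart_symm_trans_source (i k : Fin (n + 1)) :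
    ((affineChart i).symm.trans (affineChart k)).source =
      (realCoordinates n).symm ⁻¹' {w | (homogenize i w : Fin (n + 1) → ℂ) k ≠ 0} := by
  ext w
  simp [affineChart_symm_apply]

/-- The change of affine charts `(affineChart i).symm ≫ affineChart k` of `ℂℙⁿ` is real-analytic on
its source: it is the realification of the rational map `(z_j / z_i)_j ↦ (z_j / z_k)_j`
(Griffiths–Harris, Ch. 0 §2). [folklore] -/
theorem contDiffOn_affineChart_symm_trans (i k : Fin (n + 1)) :
    ContDiffOn ℝ ω ((affineChart i).symm.trans (affineChart k))
      ((affineChart i).symm.trans (affineChart k)).source := by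
  rw [affineChart_symm_trans_source]
  change ContDiffOn ℝ ω
    (realCoordinates n ∘ transitionComplex i k ∘ (realCoordinates n).symm) _
  refine (realCoordinates n).contDiff.comp_contDiffOn ?_
  exact ((contDiffOn_transitionComplex i k).restrict_scalars ℝ).comp
    (realCoordinates n).symm.contDiff.contDiffOn fun _ h ↦ h

/-- `ℂℙⁿ` is a real-analytic manifold of dimension `2 n` modelled on
`EuclideanSpace ℝ (Fin (2 * n))` (Milnor–Stasheff, §14; Griffiths–Harris, Ch. 0 §2). [folklore] -/
instance instIsManifold : IsManifold (𝓡 (2 * n)) ω (ComplexProjectiveSpace n) := by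
  refine isManifold_of_contDiffOn _ _ _ ?_
  rintro e e' ⟨i, rfl⟩ ⟨k, rfl⟩
  simpa only [modelWithCornersSelf_coe, modelWithCornersSelf_coe_symm, CompTriple.comp_eq,
    comp_id, range_id, inter_univ, preimage_id_eq, id_eq]
    using contDiffOn_affineChart_symm_trans i k

/-- `ℂℙⁿ` is a `C^m` manifold for every `m` (from the analytic structure). [folklore] -/
instance instIsManifoldOfLE (m : WithTop ℕ∞) :
    IsManifold (𝓡 (2 * n)) m (ComplexProjectiveSpace n) :=
  IsManifold.of_le (n := ω) le_top

/-! ### Point-set topology -/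

/-- The bounded continuous invariant `v ↦ (v_j conj(v_k) / ‖v‖²)_{j,k}` (the matrix of the
orthogonal projection onto the line `[v]`, up to the use of the sup norm), used to separate
points of `ℂℙⁿ`. [folklore] -/
def projectionMatrix : ComplexProjectiveSpace n → (Fin (n + 1) → Fin (n + 1) → ℂ) :=
  Projectivization.lift
    (fun v j k ↦ (v : Fin (n + 1) → ℂ) j * conj ((v : Fin (n + 1) → ℂ) k) /
      ((‖(v : Fin (n + 1) → ℂ)‖ ^ 2 : ℝ) : ℂ))
    (by
      rintro a b t h
      have ht : t ≠ 0 := by rintro rfl; exact a.2 (by simpa using h)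
      have hb : ((‖(b : Fin (n + 1) → ℂ)‖ ^ 2 : ℝ) : ℂ) ≠ 0 := by
        have := norm_ne_zero_iff.2 b.2
        exact_mod_cast pow_ne_zero 2 this
      have htt : ((‖t‖ ^ 2 : ℝ) : ℂ) = t * conj t := by
        rw [Complex.mul_conj']; push_cast; rfl
      have htc : conj t ≠ 0 := by simpa using ht
      funext j k
      simp only [h, Pi.smul_apply, smul_eq_mul, map_mul, norm_smul, mul_pow, Complex.ofReal_mul]
      rw [htt]
      field_simp)

/-- `projectionMatrix` is continuous (it lifts a continuous function of nonzero vectors). [folklore] -/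
theorem continuous_projectionMatrix : Continuous (projectionMatrix (n := n)) := by
  rw [isQuotientMap_mk.continuous_iff]
  refine continuous_pi fun j ↦ continuous_pi fun k ↦ ?_
  change Continuous fun v : {v : Fin (n + 1) → ℂ // v ≠ 0} ↦
    (v : Fin (n + 1) → ℂ) j * conj ((v : Fin (n + 1) → ℂ) k) /
      ((‖(v : Fin (n + 1) → ℂ)‖ ^ 2 : ℝ) : ℂ)
  refine Continuous.div ?_ ?_ fun v ↦ ?_
  · exact (((continuous_apply j).comp continuous_subtype_val).mul
      (Complex.continuous_conj.comp ((continuous_apply k).comp continuous_subtype_val)))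
  · exact Complex.continuous_ofReal.comp ((continuous_norm.comp continuous_subtype_val).pow 2)
  exact_mod_cast pow_ne_zero 2 (norm_ne_zero_iff.2 v.2)

/-- `projectionMatrix` is injective: `v_j conj(v_k) / ‖v‖² = w_j conj(w_k) / ‖w‖²` for all `j, k`
forces `v ∈ ℂ w`. [folklore] -/
theorem projectionMatrix_injective : Injective (projectionMatrix (n := n)) := by
  intro p q hpq
  induction p using ind with
  | h v =>
    induction q using ind with
    | h w =>
      obtain ⟨k, hk⟩ : ∃ k, (w : Fin (n + 1) → ℂ) k ≠ 0 := Function.ne_iff.1 w.2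
      have h : ∀ j l, (v : Fin (n + 1) → ℂ) j * conj ((v : Fin (n + 1) → ℂ) l) /
          ((‖(v : Fin (n + 1) → ℂ)‖ ^ 2 : ℝ) : ℂ) =
          (w : Fin (n + 1) → ℂ) j * conj ((w : Fin (n + 1) → ℂ) l) /
          ((‖(w : Fin (n + 1) → ℂ)‖ ^ 2 : ℝ) : ℂ) :=
        fun j l ↦ congr_fun (congr_fun hpq j) l
      have hv : ((‖(v : Fin (n + 1) → ℂ)‖ ^ 2 : ℝ) : ℂ) ≠ 0 := by
        exact_mod_cast pow_ne_zero 2 (norm_ne_zero_iff.2 v.2)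
      have hw : ((‖(w : Fin (n + 1) → ℂ)‖ ^ 2 : ℝ) : ℂ) ≠ 0 := by
        exact_mod_cast pow_ne_zero 2 (norm_ne_zero_iff.2 w.2)
      have hk' : conj ((w : Fin (n + 1) → ℂ) k) ≠ 0 := by simpa using hk
      have hvk : (v : Fin (n + 1) → ℂ) k ≠ 0 := by
        intro h0
        have := h k k
        rw [h0, zero_mul, zero_div, eq_comm, div_eq_zero_iff, mul_eq_zero] at this
        tauto
      have hvk' : conj ((v : Fin (n + 1) → ℂ) k) ≠ 0 := by simpa using hvk
      refine (mk_eq_mk_iff _ _).2 ⟨conj ((w : Fin (n + 1) → ℂ) k) *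
        ((‖(v : Fin (n + 1) → ℂ)‖ ^ 2 : ℝ) : ℂ) /
        (((‖(w : Fin (n + 1) → ℂ)‖ ^ 2 : ℝ) : ℂ) * conj ((v : Fin (n + 1) → ℂ) k)), ?_⟩
      funext j
      have hj := h j k
      simp only [Pi.smul_apply, smul_eq_mul]
      field_simp
      field_simp at hj
      linear_combination -hj

/-- `ℂℙⁿ` is Hausdorff: points are separated by the continuous injection `projectionMatrix`
(Milnor–Stasheff, §14). [folklore] -/
instance instT2Space : T2Space (ComplexProjectiveSpace n) :=
  .of_injective_continuous projectionMatrix_injective continuous_projectionMatrix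

/-- `ℂℙⁿ` is second countable (open quotient of a second countable space). [folklore] -/
instance instSecondCountableTopology : SecondCountableTopology (ComplexProjectiveSpace n) :=
  isQuotientMap_mk.secondCountableTopology isOpenMap_mk

/-- The restriction of `mk` to the unit sphere of `ℂⁿ⁺¹` (sup norm). [folklore] -/
def ofSphere (x : Metric.sphere (0 : Fin (n + 1) → ℂ) 1) : ComplexProjectiveSpace n :=
  mk ⟨x, ne_zero_of_mem_unit_sphere x⟩

/-- `ofSphere` is continuous. [folklore] -/
theorem continuous_ofSphere : Continuous (ofSphere (n := n)) :=
  continuous_mk.comp (continuous_subtype_val.subtype_mk _)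

/-- Every point of `ℂℙⁿ` is the class of a unit vector. [folklore] -/
theorem ofSphere_surjective : Surjective (ofSphere (n := n)) := by
  intro p
  induction p using ind with
  | h v =>
    refine ⟨⟨((‖(v : Fin (n + 1) → ℂ)‖⁻¹ : ℝ) : ℂ) • (v : Fin (n + 1) → ℂ),
      by simpa using norm_smul_inv_norm (𝕜 := ℂ) v.2⟩, ?_⟩
    exact (mk_eq_mk_iff _ _).2 ⟨_, rfl⟩

/-- `ℂℙⁿ` is compact: it is the continuous image of the unit sphere `S²ⁿ⁺¹ ⊂ ℂⁿ⁺¹`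
(Milnor–Stasheff, §14). [folklore] -/
instance instCompactSpace : CompactSpace (ComplexProjectiveSpace n) :=
  ⟨by rw [← ofSphere_surjective.range_eq]; exact isCompact_range continuous_ofSphere⟩

/-- `ℂℙⁿ` is connected: it is the continuous image of the connected space `ℂⁿ⁺¹ ∖ {0}`. [folklore] -/
instance instConnectedSpace : ConnectedSpace (ComplexProjectiveSpace n) := by
  have : ConnectedSpace {v : Fin (n + 1) → ℂ // v ≠ 0} := by
    have h1 : 1 < Module.rank ℝ (Fin (n + 1) → ℂ) := by
      apply Module.one_lt_rank_of_one_lt_finrank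
      rw [Module.finrank_pi_fintype]
      simp [Complex.finrank_real_complex, Finset.sum_const]
      omega
    exact isConnected_iff_connectedSpace.1
      (isConnected_compl_singleton_of_one_lt_rank h1 (0 : Fin (n + 1) → ℂ))
  exact mk_surjective.connectedSpace continuous_mk

end ComplexProjectiveSpace

/-! ### Literature theorems on `ℂℙⁿ` -/

/-- `ℂℙⁿ` is simply connected (it has a CW structure with even-dimensional cells only;
Milnor–Stasheff, *Characteristic Classes*, §14, Thm 14.4 ff.; Hatcher, *Algebraic Topology*,
Example 0.6 and Prop. 1.26). [cite: MilnorStasheffAMS76, §14 (Thm. 14.4 ff.: CW structure with even cells)] -/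
def simplyConnectedSpace_complexProjectiveSpace : Prop :=
  ∀ (n : ℕ),
    SimplyConnectedSpace (ComplexProjectiveSpace n)

/-- `ℂℙⁿ` is orientable, as every complex manifold is (Milnor–Stasheff, *Characteristic
Classes*, §14, Lemma 14.1 ff.; Griffiths–Harris, Ch. 0 §2). [cite: MilnorStasheffAMS76, §14 (Lemma 14.1 ff.: complex manifolds are oriented)] -/
def isOrientable_complexProjectiveSpace : Prop :=
  ∀ (n : ℕ),
    IsOrientable (𝓡 (2 * n)) (ComplexProjectiveSpace n)

/-- `ℂℙ¹` is diffeomorphic to the `2`-sphere (the Riemann sphere; Griffiths–Harris, Ch. 0 §2;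
Milnor–Stasheff, §14). The left model is written `𝓡 (2 * 1)`, the key under which the manifold
instance of `ComplexProjectiveSpace 1` is registered. [cite: GriffithsHarrisPrinciples1978, Ch. 0 §2 (ℂℙ¹ is the Riemann sphere)] -/
def nonempty_diffeomorph_complexProjectiveSpace_one_sphere : Prop :=
  Nonempty (ComplexProjectiveSpace 1 ≃ₘ⟮𝓡 (2 * 1), 𝓡 2⟯ (𝕊 2))

/-! ### The complex projective plane -/

/-- The **complex projective plane** `ℂℙ²`, a closed simply connected smooth `4`-manifold
(Milnor–Stasheff, *Characteristic Classes*, §14). [folklore] -/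
abbrev ComplexProjectivePlane : Type := ComplexProjectiveSpace 2

namespace ComplexProjectivePlane

/-- `ℂℙ²` as a charted space on the literal model `EuclideanSpace ℝ (Fin 4)` (re-export of the
instance keyed at `Fin (2 * 2)`, which instance search does not unify with `Fin 4`;
outline review #3). [folklore] -/
instance instChartedSpace : ChartedSpace (𝔼 4) ComplexProjectivePlane :=
  inferInstanceAs (ChartedSpace (𝔼 (2 * 2)) (ComplexProjectiveSpace 2))

/-- `ℂℙ²` is a real-analytic `4`-manifold modelled on `EuclideanSpace ℝ (Fin 4)` (re-export at the
literal `4` of `ComplexProjectiveSpace.instIsManifold`; Milnor–Stasheff, §14). [folklore] -/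
instance instIsManifold : IsManifold (𝓡 4) ω ComplexProjectivePlane :=
  inferInstanceAs (IsManifold (𝓡 (2 * 2)) ω (ComplexProjectiveSpace 2))

/-- `ℂℙ²` is a `C^m` `4`-manifold for every `m`. [folklore] -/
instance instIsManifoldOfLE (m : WithTop ℕ∞) : IsManifold (𝓡 4) m ComplexProjectivePlane :=
  IsManifold.of_le (n := ω) le_top

end ComplexProjectivePlane

/-- `ℂℙ²` is orientable (Milnor–Stasheff, §14), at the literal model `𝓡 4`. [folklore] -/
def isOrientable_complexProjectivePlane : Prop :=
  IsOrientable (𝓡 4) ComplexProjectivePlane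

/- interim proof relied on results that are now named facts (D-0014); demoted to a fact by the M5 import, proof preserved:
:=
  isOrientable_complexProjectiveSpace 2
-/

/-- `ℂℙ²` is simply connected (Milnor–Stasheff, §14). [folklore] -/
def simplyConnectedSpace_complexProjectivePlane : Prop :=
  SimplyConnectedSpace ComplexProjectivePlane

/- interim proof relied on results that are now named facts (D-0014); demoted to a fact by the M5 import, proof preserved:
:=
  simplyConnectedSpace_complexProjectiveSpace 2
-/

/-! Sanity checks: all instances required of a closed smooth 4-manifold in the SPC4 statements are
found by instance search at the literal model `EuclideanSpace ℝ (Fin 4)`. -/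
example : ChartedSpace (𝔼 4) ComplexProjectivePlane := inferInstance
example : IsManifold (𝓡 4) ∞ ComplexProjectivePlane := inferInstance
example : IsManifold (𝓡 4) ω ComplexProjectivePlane := inferInstance
example : BoundarylessManifold (𝓡 4) ComplexProjectivePlane := inferInstance
example : T2Space ComplexProjectivePlane := inferInstance
example : CompactSpace ComplexProjectivePlane := inferInstance
example : SecondCountableTopology ComplexProjectivePlane := inferInstance
example : ConnectedSpace ComplexProjectivePlane := inferInstance
example : Nonempty ComplexProjectivePlane := inferInstance

end Literature.Topology.FourManifolds
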